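import Mathlib
import Literature.Probability.Percolation.PercolationProofs
import Literature.Probability.LatticeModels.ProdBernoulliIndependence
import Literature.Probability.Percolation.SharpnessDCTProofs
import Summits.CriticalPhenomena.PercolationContinuityZ3.Theorems.PercNearOneGluingAdditiveGluingGoodSaturation
import HarnessLib

/-! # Crux `PercNearOneGluing.AdditiveGluing` (stmt-CriticalPhenomena-4576), line `subuniform-dead-pocket-maximum` —
the dead-pocket Markov identity and goodness with a constant selection (siege k22)

For the goodness inequality of the line (Kozma–Nitzan arXiv:2401.12397 §3.2 p. 12, skeleton selection form)
the penalty term `Σ_{W ∋ o, W ∩ A = ∅} μ(C(o) = W) · μ((sel W ↔ b in Wᶜ)ᶜ)` is a sum of PRODUCTS.  This file proves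
the identity that turns it back into one probability when the selection is constant:

* `goodPM_pocket_markov` — **dead-pocket Markov identity**: for `o ∈ W ∌ a, b'`,
  `μ({C(o) = W} ∩ {a ↮ b'}) = μ(C(o) = W) · μ((a ↔ b' in Wᶜ)ᶜ)` (the event `{C(o) = W}` is determined by the pairs
  meeting `W`, the avoided connection by the pairs inside `Wᶜ`; product measure);
* `goodPM_sum_pocket_markov` — summed over the dead pockets: `Σ_W μ(C(o) = W) · μ((a ↔ b' in Wᶜ)ᶜ) = μ(o ↮ A, a ↮ b')`;
* `goodPM_constSel_iff` — hence goodness with the CONSTANT selection `sel ≡ a₁` at the level `t = 1 − μ(a₁ ↔ b)` is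
  literally Kozma–Nitzan's pre-FKG inequality (2) designated at `a₁`: `μ(o ↔ A, a₁ ↔ b) ≤ μ(o ↔ b)`; in particular
  goodness of a quadruple implies KN's Conjecture 2 for its worst relay (`goodPM_preFKG_of_good`, KN p. 12
  "a good graph satisfies the pre-FKG conjecture").

Registered sub-goal proved by name: `stub_goodConstSel_k22`.  No new definitions; lands with
`--supports stmt-CriticalPhenomena-4576`. -/

namespace Summit.CriticalPhenomena.PercolationContinuityZ3.Theorems

open MeasureTheory Set
open Literature.Probability.LatticeModels (prodBernoulli)
open Literature.Probability.Percolation (BondConfig openConn openConnIn openGraph openCluster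
  openGraph_adj PathIn DeterminedBy determinedBy_iff)
open scoped BigOperators

noncomputable section
open Classical

variable {n : ℕ}

/-- On `{C(o) = W}` an open path from a vertex `a ∉ W` never meets `W`:
`{C(o) = W} ∩ {a ↔ b'} = {C(o) = W} ∩ {a ↔ b' in Wᶜ}`. [folklore] -/
theorem goodPM_cluster_inter_openConn (o a b' : Fin n) (W : Finset (Fin n)) (haW : a ∉ W) :
    {ω : BondConfig (Fin n) | openCluster ω o = (W : Set (Fin n))} ∩ openConn a b' =
      {ω : BondConfig (Fin n) | openCluster ω o = (W : Set (Fin n))} ∩ openConnIn ((W : Set (Fin n))ᶜ) a b' := by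
  ext ω
  simp only [Set.mem_inter_iff, Set.mem_setOf_eq]
  refine ⟨fun h => ⟨h.1, ?_⟩, fun h => ⟨h.1, ?_⟩⟩
  · obtain ⟨hW, hab⟩ := h
    have hout : ∀ y : Fin n, (openGraph ω).Reachable a y → y ∈ ((W : Set (Fin n))ᶜ : Set (Fin n)) := by
      intro y hy hyW
      have hyC : y ∈ openCluster ω o := by rw [hW]; exact hyW
      have haC : a ∈ openCluster ω o := (show (openGraph ω).Reachable o y from hyC).trans hy.symm
      rw [hW] at haC
      exact haW (Finset.mem_coe.1 haC)
    apply Literature.Probability.Percolation.DCT16.mem_openConnIn_of_pathIn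
    have hr : (openGraph ω).Reachable a b' := hab
    rw [SimpleGraph.reachable_iff_reflTransGen] at hr
    refine ⟨hout a (SimpleGraph.Reachable.refl a), ?_⟩
    clear hab
    induction hr with
    | refl => exact Relation.ReflTransGen.refl
    | @tail x y hax hxy ih =>
      exact ih.tail ⟨hxy, hout y ((SimpleGraph.reachable_iff_reflTransGen _ _).2 (hax.tail hxy))⟩
  · exact Literature.Probability.Percolation.DCT16.reachable_of_pathIn
      (Literature.Probability.Percolation.DCT16.pathIn_of_mem_openConnIn h.2)

/-- **The event `{C(o) = W}` in coordinates** (`o ∈ W`): every vertex of `W` is joined to `o` inside `W`, and every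
pair from `W` to its outside is closed. [folklore] -/
theorem goodPM_cluster_eq_iff (o : Fin n) (W : Finset (Fin n)) (hoW : o ∈ W) (ω : BondConfig (Fin n)) :
    openCluster ω o = (W : Set (Fin n)) ↔
      (∀ v ∈ W, ω ∈ openConnIn (W : Set (Fin n)) o v) ∧ (∀ x ∈ W, ∀ y : Fin n, y ∉ W → s(x, y) ∉ ω) := by
  constructor
  · intro hW
    have hin : ∀ y : Fin n, (openGraph ω).Reachable o y → y ∈ (W : Set (Fin n)) := by
      intro y hy
      rw [← hW]
      exact hy
    refine ⟨fun v hv => ?_, fun x hx y hy hxy => ?_⟩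
    · apply Literature.Probability.Percolation.DCT16.mem_openConnIn_of_pathIn
      have hr : (openGraph ω).Reachable o v := by
        have : v ∈ openCluster ω o := by rw [hW]; exact Finset.mem_coe.2 hv
        exact this
      rw [SimpleGraph.reachable_iff_reflTransGen] at hr
      refine ⟨Finset.mem_coe.2 hoW, ?_⟩
      clear hv
      induction hr with
      | refl => exact Relation.ReflTransGen.refl
      | @tail x y hox hxy ih =>
        exact ih.tail ⟨hxy, hin y ((SimpleGraph.reachable_iff_reflTransGen _ _).2 (hox.tail hxy))⟩
    · have hne : x ≠ y := fun h => hy (h ▸ hx)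
      have hadj : (openGraph ω).Adj x y := (openGraph_adj ω x y).2 ⟨hxy, hne⟩
      have hxr : (openGraph ω).Reachable o x := by
        have : x ∈ openCluster ω o := by rw [hW]; exact Finset.mem_coe.2 hx
        exact this
      exact hy (Finset.mem_coe.1 (hin y (hxr.trans hadj.reachable)))
  · rintro ⟨hspan, hbdry⟩
    ext z
    constructor
    · intro hz
      have hr : (openGraph ω).Reachable o z := hz
      rw [SimpleGraph.reachable_iff_reflTransGen] at hr
      clear hz
      induction hr with
      | refl => exact Finset.mem_coe.2 hoW
      | @tail x y _ hxy ih =>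
        by_contra hyW
        have h' := (openGraph_adj ω x y).1 hxy
        exact hbdry x (Finset.mem_coe.1 ih) y (fun h => hyW (Finset.mem_coe.2 h)) h'.1
    · intro hz
      exact Literature.Probability.Percolation.DCT16.reachable_of_pathIn
        (Literature.Probability.Percolation.DCT16.pathIn_of_mem_openConnIn (hspan z (Finset.mem_coe.1 hz)))

/-- `{C(o) = W}` is determined by the pairs meeting `W` (`o ∈ W`). [folklore] -/
theorem goodPM_determinedBy_cluster_eq (o : Fin n) (W : Finset (Fin n)) (hoW : o ∈ W) :
    DeterminedBy {ω : BondConfig (Fin n) | openCluster ω o = (W : Set (Fin n))}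
      (↑(Finset.univ.filter fun e : Sym2 (Fin n) => ∃ x ∈ W, x ∈ e) : Set (Sym2 (Fin n))) := by
  rw [determinedBy_iff]
  intro ω ω' h
  simp only [Set.mem_setOf_eq]
  rw [goodPM_cluster_eq_iff o W hoW ω, goodPM_cluster_eq_iff o W hoW ω']
  have hsym : (W : Set (Fin n)).sym2 ⊆
      (↑(Finset.univ.filter fun e : Sym2 (Fin n) => ∃ x ∈ W, x ∈ e) : Set (Sym2 (Fin n))) := by
    intro e he
    rw [Finset.coe_filter]
    refine ⟨Finset.mem_univ _, ?_⟩
    induction e using Sym2.ind with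
    | h x y => exact ⟨x, Finset.mem_coe.1 (Set.mk_mem_sym2_iff.1 he).1, Sym2.mem_mk_left x y⟩
  have hmem : ∀ x ∈ W, ∀ y : Fin n, (s(x, y) ∈ ω ↔ s(x, y) ∈ ω') := by
    intro x hx y
    have he : s(x, y) ∈ (↑(Finset.univ.filter fun e : Sym2 (Fin n) => ∃ x ∈ W, x ∈ e) : Set (Sym2 (Fin n))) := by
      rw [Finset.coe_filter]
      exact ⟨Finset.mem_univ _, x, hx, Sym2.mem_mk_left x y⟩
    exact ⟨fun h1 => ((Set.ext_iff.1 h _).1 ⟨h1, he⟩).1, fun h1 => ((Set.ext_iff.1 h _).2 ⟨h1, he⟩).1⟩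
  refine and_congr (forall₂_congr fun v _ => ?_) (forall₂_congr fun x hx => forall₂_congr fun y _ => ?_)
  · exact (determinedBy_iff _ _).1
      (Literature.Probability.Percolation.DCT16.determinedBy_openConnIn (W : Set (Fin n)) o v hsym) ω ω' h
  · exact not_congr (hmem x hx y)

/-- **Dead-pocket Markov identity.** For `o ∈ W` and `a, b' ∉ W`:
`μ({C(o) = W} ∩ {a ↮ b'}) = μ(C(o) = W) · μ((a ↔ b' in Wᶜ)ᶜ)` — on `{C(o) = W}` the connection `a ↔ b'`
avoids `W`, `{C(o) = W}` is determined by the pairs meeting `W` and `{a ↔ b' in Wᶜ}` by the pairs inside `Wᶜ`,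
which are independent under the product measure. [folklore; Kozma–Nitzan arXiv:2401.12397 proof of Thm 5 p. 14] -/
theorem goodPM_pocket_markov (w : Sym2 (Fin n) → unitInterval) (o a b' : Fin n) (W : Finset (Fin n))
    (hoW : o ∈ W) (haW : a ∉ W) :
    (prodBernoulli w).real
        ({ω : BondConfig (Fin n) | openCluster ω o = (W : Set (Fin n))} ∩ (openConn a b')ᶜ) =
      (prodBernoulli w).real {ω : BondConfig (Fin n) | openCluster ω o = (W : Set (Fin n))} *
        (prodBernoulli w).real (openConnIn ((W : Set (Fin n))ᶜ) a b')ᶜ := by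
  have hset : {ω : BondConfig (Fin n) | openCluster ω o = (W : Set (Fin n))} ∩ (openConn a b')ᶜ =
      {ω : BondConfig (Fin n) | openCluster ω o = (W : Set (Fin n))} ∩ (openConnIn ((W : Set (Fin n))ᶜ) a b')ᶜ := by
    have h := goodPM_cluster_inter_openConn o a b' W haW
    ext ω
    simp only [Set.mem_inter_iff, Set.mem_compl_iff]
    constructor
    · rintro ⟨h1, h2⟩
      exact ⟨h1, fun h3 => h2 ((Set.ext_iff.1 h ω).2 ⟨h1, h3⟩).2⟩
    · rintro ⟨h1, h2⟩
      exact ⟨h1, fun h3 => h2 ((Set.ext_iff.1 h ω).1 ⟨h1, h3⟩).2⟩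
  rw [hset]
  refine Literature.Probability.LatticeModels.prodBernoulli_real_inter_of_determinedBy_disjoint w
    (F := Finset.univ.filter fun e : Sym2 (Fin n) => ∃ x ∈ W, x ∈ e)
    (F' := Finset.univ.filter fun e : Sym2 (Fin n) => ∀ x ∈ e, x ∉ W) ?_
    (goodPM_determinedBy_cluster_eq o W hoW) ?_ (Set.toFinite _).measurableSet (Set.toFinite _).measurableSet
  · rw [Finset.disjoint_left]
    intro e he he'
    obtain ⟨x, hxW, hxe⟩ := (Finset.mem_filter.1 he).2
    exact (Finset.mem_filter.1 he').2 x hxe hxW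
  · have hK : ((W : Set (Fin n))ᶜ).sym2 ⊆
        (↑(Finset.univ.filter fun e : Sym2 (Fin n) => ∀ x ∈ e, x ∉ W) : Set (Sym2 (Fin n))) := by
      intro e he
      rw [Finset.coe_filter]
      refine ⟨Finset.mem_univ _, fun x hx => ?_⟩
      exact Set.mem_sym2_iff_subset.1 he hx
    have hd := Literature.Probability.Percolation.DCT16.determinedBy_openConnIn
      ((W : Set (Fin n))ᶜ) a b' hK
    rw [determinedBy_iff] at hd ⊢
    intro ω ω' h
    exact not_congr (hd ω ω' h)

/-- **Summed dead-pocket Markov identity.** For `b ∈ A`, `a, b' ∈ A`: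
`Σ_{W ∋ o, W ∩ A = ∅} μ(C(o) = W) · μ((a ↔ b' in Wᶜ)ᶜ) = μ(o ↮ A, a ↮ b')` (the dead pockets are the disjoint
fibres of the cluster map inside `{o ↮ A}`). [folklore] -/
theorem goodPM_sum_pocket_markov (w : Sym2 (Fin n) → unitInterval) (A : Finset (Fin n)) (o b a b' : Fin n)
    (hbA : b ∈ A) (haA : a ∈ A) :
    ∑ W ∈ (Finset.univ : Finset (Finset (Fin n))).filter (fun W => o ∈ W ∧ Disjoint W A),
        (prodBernoulli w).real {ω : BondConfig (Fin n) | openCluster ω o = (W : Set (Fin n))}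
          * (prodBernoulli w).real (openConnIn ((W : Set (Fin n))ᶜ) a b')ᶜ =
      (prodBernoulli w).real ((⋃ x ∈ A, (openConn o x : Set (BondConfig (Fin n))))ᶜ ∩ (openConn a b')ᶜ) := by
  set f : BondConfig (Fin n) → Finset (Fin n) :=
    fun ω => Finset.univ.filter fun x : Fin n => x ∈ openCluster ω o with hf
  set F : Set (BondConfig (Fin n)) :=
    (⋃ x ∈ A, (openConn o x : Set (BondConfig (Fin n))))ᶜ ∩ (openConn a b')ᶜ with hF
  have hterm : ∀ W ∈ (Finset.univ : Finset (Finset (Fin n))).filter (fun W => o ∈ W ∧ Disjoint W A),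
      (prodBernoulli w).real {ω : BondConfig (Fin n) | openCluster ω o = (W : Set (Fin n))}
          * (prodBernoulli w).real (openConnIn ((W : Set (Fin n))ᶜ) a b')ᶜ =
        (prodBernoulli w).real (f ⁻¹' {W} ∩ F) := by
    intro W hW
    obtain ⟨hoW, hWA⟩ := (Finset.mem_filter.1 hW).2
    have haW : a ∉ W := fun h => Finset.disjoint_left.1 hWA h haA
    rw [← goodPM_pocket_markov w o a b' W hoW haW, hf, goodSat_preimage_cluster o W, hF]
    congr 1
    ext ω
    simp only [Set.mem_inter_iff]
    constructor
    · rintro ⟨h1, h2⟩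
      exact ⟨h1, (goodSat_dead_subset A W o b hbA hWA h1).2, h2⟩
    · rintro ⟨h1, -, h2⟩
      exact ⟨h1, h2⟩
  rw [Finset.sum_congr rfl hterm, ← sigmaRec_sum_preimage_inter w f F]
  refine Finset.sum_subset (Finset.filter_subset _ _) fun W _ hW => ?_
  -- off the dead pockets the fibre misses `F`
  have hW' : ¬ (o ∈ W ∧ Disjoint W A) := fun h => hW (Finset.mem_filter.2 ⟨Finset.mem_univ _, h⟩)
  have hempty : f ⁻¹' {W} ∩ F = ∅ := by
    ext ω
    simp only [Set.mem_inter_iff, Set.mem_empty_iff_false, iff_false, not_and]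
    intro hω hωF
    rw [hf, goodSat_preimage_cluster o W] at hω
    have hWeq : openCluster ω o = (W : Set (Fin n)) := hω
    apply hW'
    refine ⟨?_, Finset.disjoint_left.2 fun x hxW hxA => ?_⟩
    · have : o ∈ openCluster ω o := Literature.Probability.Percolation.mem_openCluster_self ω o
      rw [hWeq] at this
      exact Finset.mem_coe.1 this
    · have hxC : x ∈ openCluster ω o := by rw [hWeq]; exact Finset.mem_coe.2 hxW
      rw [hF] at hωF
      exact hωF.1 (Set.mem_iUnion₂.2 ⟨x, hxA, hxC⟩)
  rw [hempty, measureReal_empty]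

/-- **Goodness with a constant selection is the designated pre-FKG inequality.** For `b ∈ A`, `a₁ ∈ A`, the
goodness inequality with the constant selection `sel ≡ a₁` at the level `t = 1 − μ(a₁ ↔ b)` holds iff
`μ(o ↔ A, a₁ ↔ b) ≤ μ(o ↔ b)` (Kozma–Nitzan arXiv:2401.12397 (2) designated at `a₁`; KN p. 12). -/
theorem goodPM_constSel_iff (w : Sym2 (Fin n) → unitInterval) (A : Finset (Fin n)) (o b a₁ : Fin n)
    (hbA : b ∈ A) (ha₁ : a₁ ∈ A) :
    ((prodBernoulli w).real ((⋃ a ∈ A, openConn o a) ∩ (openConn o b)ᶜ)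
        + ∑ W ∈ (Finset.univ : Finset (Finset (Fin n))).filter (fun W => o ∈ W ∧ Disjoint W A),
            (prodBernoulli w).real {ω : BondConfig (Fin n) | openCluster ω o = (W : Set (Fin n))}
              * (prodBernoulli w).real (openConnIn ((W : Set (Fin n))ᶜ) ((fun _ => a₁) W) b)ᶜ
        ≤ 1 - (prodBernoulli w).real (openConn a₁ b)) ↔
      (prodBernoulli w).real ((⋃ a ∈ A, (openConn o a : Set (BondConfig (Fin n)))) ∩ openConn a₁ b) ≤
        (prodBernoulli w).real (openConn o b) := by
  rw [goodPM_sum_pocket_markov w A o b a₁ b hbA ha₁]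
  set U : Set (BondConfig (Fin n)) := ⋃ a ∈ A, (openConn o a : Set (BondConfig (Fin n))) with hU
  set B : Set (BondConfig (Fin n)) := openConn o b with hB
  have hBU : B ⊆ U := fun ω hω => Set.mem_iUnion₂.2 ⟨b, hbA, hω⟩
  have h1 : (prodBernoulli w).real (U ∩ Bᶜ) = (prodBernoulli w).real U - (prodBernoulli w).real B := by
    rw [← Set.sdiff_eq, measureReal_sdiff hBU (Set.toFinite _).measurableSet (measure_ne_top _ _)]
  have h2 : (prodBernoulli w).real (Uᶜ ∩ (openConn a₁ b : Set (BondConfig (Fin n)))ᶜ)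
      + (prodBernoulli w).real (U ∩ (openConn a₁ b : Set (BondConfig (Fin n)))ᶜ) =
      (prodBernoulli w).real (openConn a₁ b : Set (BondConfig (Fin n)))ᶜ := by
    rw [← measureReal_union (Set.disjoint_left.2 fun ω h1 h2 => h1.1 h2.1) (Set.toFinite _).measurableSet]
    congr 1
    ext ω
    simp only [Set.mem_union, Set.mem_inter_iff, Set.mem_compl_iff]
    tauto
  have h3 : (prodBernoulli w).real (U ∩ (openConn a₁ b : Set (BondConfig (Fin n)))ᶜ)
      + (prodBernoulli w).real (U ∩ openConn a₁ b) = (prodBernoulli w).real U := by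
    rw [← measureReal_union (Set.disjoint_left.2 fun ω h1 h2 => h1.2 h2.2) (Set.toFinite _).measurableSet]
    congr 1
    ext ω
    simp only [Set.mem_union, Set.mem_inter_iff, Set.mem_compl_iff]
    tauto
  have h4 : (prodBernoulli w).real (openConn a₁ b : Set (BondConfig (Fin n)))ᶜ =
      1 - (prodBernoulli w).real (openConn a₁ b) :=
    probReal_compl_eq_one_sub (Set.toFinite _).measurableSet
  constructor
  · intro h; linarith
  · intro h; linarith

/-- **A good quadruple satisfies the designated pre-FKG inequality** (Kozma–Nitzan arXiv:2401.12397 p. 12): if the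
goodness inequality holds for every selection at the level `t = 1 − μ(a₁ ↔ b)` (admissible when `a₁` is a worst relay),
then `μ(o ↔ A, a₁ ↔ b) ≤ μ(o ↔ b)`. -/
theorem goodPM_preFKG_of_good (w : Sym2 (Fin n) → unitInterval) (A : Finset (Fin n)) (o b a₁ : Fin n)
    (hbA : b ∈ A) (ha₁ : a₁ ∈ A)
    (hgood : ∀ sel : Finset (Fin n) → Fin n, (∀ W, sel W ∈ A) →
      (prodBernoulli w).real ((⋃ a ∈ A, openConn o a) ∩ (openConn o b)ᶜ)
        + ∑ W ∈ (Finset.univ : Finset (Finset (Fin n))).filter (fun W => o ∈ W ∧ Disjoint W A),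
            (prodBernoulli w).real {ω : BondConfig (Fin n) | openCluster ω o = (W : Set (Fin n))}
              * (prodBernoulli w).real (openConnIn ((W : Set (Fin n))ᶜ) (sel W) b)ᶜ
        ≤ 1 - (prodBernoulli w).real (openConn a₁ b)) :
    (prodBernoulli w).real ((⋃ a ∈ A, (openConn o a : Set (BondConfig (Fin n)))) ∩ openConn a₁ b) ≤
      (prodBernoulli w).real (openConn o b) :=
  (goodPM_constSel_iff w A o b a₁ hbA ha₁).1 (hgood (fun _ => a₁) fun _ => ha₁)

/-- **Registered sub-goal `stub_goodConstSel_k22`** (closed form of `goodPM_constSel_iff`): goodness with the constant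
selection `a₁` at level `1 − μ(a₁ ↔ b)` is Kozma–Nitzan's designated pre-FKG inequality `μ(o ↔ A, a₁ ↔ b) ≤ μ(o ↔ b)`
(arXiv:2401.12397 §3.2 p. 12). -/
theorem stub_goodConstSel_k22 : ∀ (n : ℕ) (w : Sym2 (Fin n) → unitInterval) (A : Finset (Fin n)) (o b a₁ : Fin n), b ∈ A → a₁ ∈ A → (((prodBernoulli w).real ((⋃ a ∈ A, openConn o a) ∩ (openConn o b)ᶜ) + ∑ W ∈ (Finset.univ : Finset (Finset (Fin n))).filter (fun W => o ∈ W ∧ Disjoint W A), (prodBernoulli w).real {ω : BondConfig (Fin n) | openCluster ω o = (W : Set (Fin n))} * (prodBernoulli w).real (openConnIn ((W : Set (Fin n))ᶜ) a₁ b)ᶜ ≤ 1 - (prodBernoulli w).real (openConn a₁ b)) ↔ (prodBernoulli w).real ((⋃ a ∈ A, openConn o a) ∩ openConn a₁ b) ≤ (prodBernoulli w).real (openConn o b)) := by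
  intro n w A o b a₁ hbA ha₁
  exact goodPM_constSel_iff w A o b a₁ hbA ha₁

end

end Summit.CriticalPhenomena.PercolationContinuityZ3.Theorems
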